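import Literature.NumberTheory.NumberFields.RayClassFieldAdicCharacterTower
import Literature.NumberTheory.NumberFields.RayClassFieldAdicCharacterPrincipal
import Literature.NumberTheory.EllipticCurves.ProfiniteGroupDistributionCharacterDivision
import HarnessLib

/-!
# The division data of de Shalit II.4.12 on the GLOBAL ray class tower `Gal(K̄/K(𝔪'v^{n+1}))`:
# for `𝔞₁ = (α)`, `α ≡ 1 mod 𝔪'`, `v(α − 1) = s + 1` exactly (`p = 2 → 1 ≤ s`), the Artin symbol
# `σ_(α)` satisfies `hgen`/`hpow`/`hunb`/`hcent`/`hτ` of `exists_twisting_μ_eq_of_cocycle_natCast` (part 5)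

De Shalit 1987, II.4.12 (p. 66–68): to divide `μ_𝔞 = 12(σ_𝔞 − N𝔞)μ(𝔣)` one picks `𝔞₁ = (α₁)` with
`α₁ ≡ 1 mod 𝔣` and `σ_{𝔞₁}` "a topological generator of `Gal(K(𝔣𝔭^∞)/K(𝔣𝔭ˢ))`" — through
`κ : Gal(K(𝔣𝔭^∞)/K(𝔣)) ≅ ℤ_pˣ` (II.1.7, I.3.3 (9)): `v_𝔭(α₁ − 1) = s` exactly, with `s ≥ 2` at `p = 2`
(II.4.17 "`1 + 4ℤ₂` if `p = 2`", p. 78). The tree's division theorem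
`GroupDistribution.exists_twisting_μ_eq_of_cocycle_natCast` (p704309) takes this as `hgen`/`hpow`/`hunb`/
`hcent`/`hτ` on an abstract tower; `ProfiniteGroupDistributionCharacterDivision.lean` derived them from a
character `κ : G →* ℤ_pˣ` cutting out the tower and `κσ₁ ≡ 1 mod p^{s+1}`, `≢ mod p^{s+2}`; parts 1–4
(`RayClassFieldAdic{ArtinValue,Character,CharacterTower,CharacterPrincipal}.lean`) built, by class field
theory, the tower `rayAdicTower h𝔪' v` of `G = Gal(K̄/K(𝔪))` (`U_n = Gal(K̄/K(𝔪'v^{n+1}))`, `𝔪 ∣ 𝔪'`), the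
character `κ_p = e ∘ rayAdicCharacter`, its `hU`/`hκ`, and `κ(σ_(α)) = α_v⁻¹`. THIS FILE assembles:
for `K` totally complex, `0 ≠ 𝔪' ⊆ 𝔪`, `v ∤ 𝔪`, `w_𝔪 = 1`, `e : 𝒪_v ≃+* ℤ_p`, and `α ∈ 𝓞 K`, `α ≠ 0`,
`α − 1 ∈ 𝔪'`, `α ∉ v`, and ANY `σ ∈ Γ_K` restricting to `((α), K(𝔪'vⁿ)/K)` on every `K(𝔪'vⁿ)`
(such `σ` exist: `exists_forall_absRestrictNormalHom_eq_artinHom_span_singleton`):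

* `toZModPow_padicRayAdicCharacter_artin_eq_one_iff` — **`κ_p(σ_(α)) ≡ 1 mod pⁿ ↔ α − 1 ∈ vⁿ`**;
* `artin_mem_rayAdicTower_U_iff` — `σ_(α) ∈ U_n ↔ α − 1 ∈ v^{n+1}`;
* ★★ `hgen_artin` / `hpow_artin` / `hunb_artin` — for `α − 1 ∈ v^{s+1} ∖ v^{s+2}` and `p = 2 → 1 ≤ s`:
  the hypotheses `hgen`, `hpow`, `hunb` of `exists_twisting_μ_eq_of_cocycle_natCast` for
  `(rayAdicTower h𝔪' v, σ_(α))` VERBATIM; `hcent_rayAdicTower` — `hcent` (every `U_m` contains the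
  commutators of `Γ_K`, `K(𝔪'v^{m+1})/K` being abelian);
* `hτ_artin` — `hτ` for two such Artin symbols `σ_(α)`, `σ_(β)` as soon as `βᵏ ≠ αᵏ` in `K_v` for
  `k > 0` (e.g. `β = ᾱ`, `α/ᾱ` not a root of unity — de Shalit's `𝔞₂ = 𝔞̄₁`).

Everything is a theorem; no definitions, no named facts, no instances, no `sorry`. The levels of
`rayAdicTower` are normal (`rayAdicTower_U_normal`); where `orderOf`/`proj` on the quotients are used the
normality is taken as an instance binder, discharged by that theorem.

## References

* [deShalit1987] E. de Shalit, *Iwasawa theory of elliptic curves with complex multiplication* (1987),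
  II.4.12 (p. 66–68), II.4.17 (p. 77–78), II.1.7–1.9 (p. 41–43), I.3.3 (9) (p. 18).
* [NeukirchANT1999] J. Neukirch, *Algebraic Number Theory* (1999), Ch. IV §1 (1.1), Ch. VI §7 Thm. (7.1).
-/

noncomputable section

open NumberField IsDedekindDomain IsDedekindDomain.HeightOneSpectrum Field
open scoped nonZeroDivisors Classical

namespace Literature.NumberTheory.NumberFields

open Literature.NumberTheory.GaloisRepresentations
open Literature.NumberTheory.EllipticCurves (SubgroupTower)

variable {K : Type} [Field K] [NumberField K]

/-! ### §7. The Artin symbol of `(α)` in the tower `rayAdicTower h𝔪' v` -/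

section Artin

variable [IsTotallyComplex K] {𝔪 𝔪' : Ideal (𝓞 K)} {v : HeightOneSpectrum (𝓞 K)} {p : ℕ} [hp : Fact p.Prime]

/-- **`σ_(α) ∈ U_n ↔ α − 1 ∈ v^{n+1}`** in the tower `rayAdicTower h𝔪' v` of `Gal(K̄/K(𝔪))`, for any
`σ ∈ Γ_K` restricting to `((α), K(𝔪'vⁿ)/K)` on every `K(𝔪'vⁿ)` (`α ≡ 1 mod 𝔪'`, `v ∤ α`, `w_{𝔪'} = 1`).
[cite: deShalit1987, II.4.12 (p. 66–67)] [cite: NeukirchANT1999, Ch. VI §7 Thm. (7.1)] -/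
theorem artin_mem_rayAdicTower_U_iff (h𝔪' : 𝔪' ≠ ⊥) (hv' : ¬ 𝔪' ≤ v.asIdeal)
    (hw' : ∀ u : (𝓞 K)ˣ, (u : 𝓞 K) - 1 ∈ 𝔪' → u = 1) {α : 𝓞 K} (hα0 : α ≠ 0) (hα𝔪 : α - 1 ∈ 𝔪')
    (hαv : α ∉ v.asIdeal) {σ : absoluteGaloisGroup K}
    (hσ : ∀ n : ℕ, absRestrictNormalHom (rayClassField K (𝔪' * v.asIdeal ^ n)) σ =
      artinHom (galFrob K (rayClassField K (𝔪' * v.asIdeal ^ n)))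
        (toPrincipalIdeal (𝓞 K) K (Units.mk0 (α : K) (by exact_mod_cast hα0))))
    (hσ𝔪 : σ ∈ (absRestrictNormalHom (rayClassField K 𝔪)).ker) (n : ℕ) :
    (⟨σ, hσ𝔪⟩ : ↥(absRestrictNormalHom (rayClassField K 𝔪)).ker) ∈ (rayAdicTower (𝔪 := 𝔪) h𝔪' v).U n ↔
      α - 1 ∈ v.asIdeal ^ (n + 1) := by
  rw [mem_rayAdicTower_U_iff, MonoidHom.mem_ker, hσ (n + 1),
    artinHom_toPrincipalIdeal_rayClassField_mul_pow_eq_one_iff h𝔪' hv' hw' hα0 hα𝔪 hαv (n + 1)]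

/-- **`κ_p(σ_(α)) ≡ 1 mod pⁿ ↔ α − 1 ∈ vⁿ`** with `κ_p = e ∘ κ` the character above `𝔪 ⊇ 𝔪'`
(`κ(σ_(α)) = α_v⁻¹`). [cite: deShalit1987, II.4.12 (p. 67), II.1.7 (p. 41)] -/
theorem toZModPow_padicRayAdicCharacter_artin_eq_one_iff (h𝔪' : 𝔪' ≠ ⊥) (h𝔪 : 𝔪 ≠ ⊥)
    (hv : ¬ 𝔪 ≤ v.asIdeal) (hw : ∀ u : (𝓞 K)ˣ, (u : 𝓞 K) - 1 ∈ 𝔪 → u = 1)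
    (e : v.adicCompletionIntegers K ≃+* ℤ_[p]) (hle : 𝔪' ≤ 𝔪) (hv' : ¬ 𝔪' ≤ v.asIdeal)
    {α : 𝓞 K} (hα0 : α ≠ 0) (hα𝔪 : α - 1 ∈ 𝔪') (hαv : α ∉ v.asIdeal) {σ : absoluteGaloisGroup K}
    (hσ : ∀ n : ℕ, absRestrictNormalHom (rayClassField K (𝔪' * v.asIdeal ^ n)) σ =
      artinHom (galFrob K (rayClassField K (𝔪' * v.asIdeal ^ n)))
        (toPrincipalIdeal (𝓞 K) K (Units.mk0 (α : K) (by exact_mod_cast hα0))))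
    (hσ𝔪 : σ ∈ (absRestrictNormalHom (rayClassField K 𝔪)).ker) (n : ℕ) :
    PadicInt.toZModPow n (((Units.map (e : v.adicCompletionIntegers K →+* ℤ_[p]).toMonoidHom).comp
        (rayAdicCharacter h𝔪 hv hw) ⟨σ, hσ𝔪⟩ : ℤ_[p]ˣ) : ℤ_[p]) = 1 ↔ α - 1 ∈ v.asIdeal ^ n := by
  have hw' := units_eq_one_of_sub_one_mem_of_le hle hw
  have hσ' : σ ∈ (absRestrictNormalHom (rayClassField K 𝔪')).ker :=
    mem_ker_of_forall_absRestrictNormalHom_eq_artinHom h𝔪' hv' hα0 hα𝔪 hαv hσ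
  rw [coe_padicRayAdicCharacter_apply, toZModPow_map_eq_one_iff_valued,
    show (⟨σ, hσ𝔪⟩ : ↥(absRestrictNormalHom (rayClassField K 𝔪)).ker) =
      ⟨σ, ker_absRestrictNormalHom_rayClassField_anti h𝔪' hle hσ'⟩ from rfl,
    rayAdicCharacter_eq_of_le h𝔪 hv hw h𝔪' hle hv' hw' ⟨σ, hσ'⟩,
    ← mem_ker_rayClassField_mul_pow_iff_valued h𝔪' hv' hw' ⟨σ, hσ'⟩ n, MonoidHom.mem_ker, hσ n,
    artinHom_toPrincipalIdeal_rayClassField_mul_pow_eq_one_iff h𝔪' hv' hw' hα0 hα𝔪 hαv n]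

/-- ★★ **`hgen` for `σ_(α)` on the global tower**: `σ_(α)` generates `U_s = Gal(K̄/K(𝔪'v^{s+1}))`
modulo every `U_m` (`α − 1 ∈ v^{s+1} ∖ v^{s+2}`; `p = 2 → 1 ≤ s`) — de Shalit's «`σ_{𝔞₁}` restricted to
`Gal(K(𝔣𝔭^∞)/K(𝔣𝔭ˢ))` is a topological generator», the hypothesis `hgen` of
`exists_twisting_μ_eq_of_cocycle_natCast` VERBATIM. [cite: deShalit1987, II.4.12 (p. 66–67), II.4.17 (p. 78)] -/
theorem hgen_artin (h𝔪' : 𝔪' ≠ ⊥) (h𝔪 : 𝔪 ≠ ⊥) (hv : ¬ 𝔪 ≤ v.asIdeal)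
    (hw : ∀ u : (𝓞 K)ˣ, (u : 𝓞 K) - 1 ∈ 𝔪 → u = 1) (e : v.adicCompletionIntegers K ≃+* ℤ_[p])
    (hle : 𝔪' ≤ 𝔪) (hv' : ¬ 𝔪' ≤ v.asIdeal) {α : 𝓞 K} (hα0 : α ≠ 0) (hα𝔪 : α - 1 ∈ 𝔪')
    (hαv : α ∉ v.asIdeal) {σ : absoluteGaloisGroup K}
    (hσ : ∀ n : ℕ, absRestrictNormalHom (rayClassField K (𝔪' * v.asIdeal ^ n)) σ =
      artinHom (galFrob K (rayClassField K (𝔪' * v.asIdeal ^ n)))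
        (toPrincipalIdeal (𝓞 K) K (Units.mk0 (α : K) (by exact_mod_cast hα0))))
    (hσ𝔪 : σ ∈ (absRestrictNormalHom (rayClassField K 𝔪)).ker) {s : ℕ}
    (hs1 : α - 1 ∈ v.asIdeal ^ (s + 1)) (hs2 : α - 1 ∉ v.asIdeal ^ (s + 2)) (hp2 : p = 2 → 1 ≤ s) :
    ∀ m, s ≤ m → ∀ u ∈ (rayAdicTower (𝔪 := 𝔪) h𝔪' v).U s, ∃ k : ℕ,
      (rayAdicTower (𝔪 := 𝔪) h𝔪' v).proj m ((⟨σ, hσ𝔪⟩ : ↥(absRestrictNormalHom (rayClassField K 𝔪)).ker) ^ k) =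
        (rayAdicTower (𝔪 := 𝔪) h𝔪' v).proj m u :=
  SubgroupTower.hgen_of_character (rayAdicTower (𝔪 := 𝔪) h𝔪' v) _ (mem_rayAdicTower_iff h𝔪' h𝔪 hv hw e hle hv')
    ((artin_mem_rayAdicTower_U_iff h𝔪' hv' (units_eq_one_of_sub_one_mem_of_le hle hw) hα0 hα𝔪 hαv hσ hσ𝔪 0).mpr
      (by rw [zero_add, pow_one]; exact Ideal.pow_le_self (Nat.succ_ne_zero s) hs1))
    ((toZModPow_padicRayAdicCharacter_artin_eq_one_iff h𝔪' h𝔪 hv hw e hle hv' hα0 hα𝔪 hαv hσ hσ𝔪 (s + 1)).mpr hs1)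
    (fun h ↦ hs2 ((toZModPow_padicRayAdicCharacter_artin_eq_one_iff h𝔪' h𝔪 hv hw e hle hv' hα0 hα𝔪 hαv hσ
      hσ𝔪 (s + 2)).mp h)) hp2

/-- ★★ **`hpow` for `σ_(α)`**: its order modulo `U_n` is a power of `p` (`n ≥ s`) — the hypothesis `hpow`
of `exists_twisting_μ_eq_of_cocycle_natCast` VERBATIM (normality of the levels: `rayAdicTower_U_normal`).
[cite: deShalit1987, II.4.12 (p. 67)] -/
theorem hpow_artin (h𝔪' : 𝔪' ≠ ⊥) [∀ n, ((rayAdicTower (𝔪 := 𝔪) h𝔪' v).U n).Normal] (h𝔪 : 𝔪 ≠ ⊥)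
    (hv : ¬ 𝔪 ≤ v.asIdeal) (hw : ∀ u : (𝓞 K)ˣ, (u : 𝓞 K) - 1 ∈ 𝔪 → u = 1)
    (e : v.adicCompletionIntegers K ≃+* ℤ_[p]) (hle : 𝔪' ≤ 𝔪) (hv' : ¬ 𝔪' ≤ v.asIdeal)
    {α : 𝓞 K} (hα0 : α ≠ 0) (hα𝔪 : α - 1 ∈ 𝔪') (hαv : α ∉ v.asIdeal) {σ : absoluteGaloisGroup K}
    (hσ : ∀ n : ℕ, absRestrictNormalHom (rayClassField K (𝔪' * v.asIdeal ^ n)) σ =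
      artinHom (galFrob K (rayClassField K (𝔪' * v.asIdeal ^ n)))
        (toPrincipalIdeal (𝓞 K) K (Units.mk0 (α : K) (by exact_mod_cast hα0))))
    (hσ𝔪 : σ ∈ (absRestrictNormalHom (rayClassField K 𝔪)).ker) {s : ℕ}
    (hs1 : α - 1 ∈ v.asIdeal ^ (s + 1)) (hs2 : α - 1 ∉ v.asIdeal ^ (s + 2)) (hp2 : p = 2 → 1 ≤ s) :
    ∀ n, s ≤ n → ∃ a : ℕ,
      orderOf ((rayAdicTower (𝔪 := 𝔪) h𝔪' v).proj n (⟨σ, hσ𝔪⟩ : ↥(absRestrictNormalHom (rayClassField K 𝔪)).ker)) =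
        p ^ a :=
  SubgroupTower.hpow_of_character (rayAdicTower (𝔪 := 𝔪) h𝔪' v) _ (mem_rayAdicTower_iff h𝔪' h𝔪 hv hw e hle hv')
    ((artin_mem_rayAdicTower_U_iff h𝔪' hv' (units_eq_one_of_sub_one_mem_of_le hle hw) hα0 hα𝔪 hαv hσ hσ𝔪 0).mpr
      (by rw [zero_add, pow_one]; exact Ideal.pow_le_self (Nat.succ_ne_zero s) hs1))
    ((toZModPow_padicRayAdicCharacter_artin_eq_one_iff h𝔪' h𝔪 hv hw e hle hv' hα0 hα𝔪 hαv hσ hσ𝔪 (s + 1)).mpr hs1)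
    (fun h ↦ hs2 ((toZModPow_padicRayAdicCharacter_artin_eq_one_iff h𝔪' h𝔪 hv hw e hle hv' hα0 hα𝔪 hαv hσ
      hσ𝔪 (s + 2)).mp h)) hp2

/-- ★★ **`hunb` for `σ_(α)`**: its orders modulo `U_m` are unbounded powers of `p` — the hypothesis `hunb`
of `exists_twisting_μ_eq_of_cocycle_natCast` VERBATIM. [cite: deShalit1987, II.4.12 (p. 67)] -/
theorem hunb_artin (h𝔪' : 𝔪' ≠ ⊥) [∀ n, ((rayAdicTower (𝔪 := 𝔪) h𝔪' v).U n).Normal] (h𝔪 : 𝔪 ≠ ⊥)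
    (hv : ¬ 𝔪 ≤ v.asIdeal) (hw : ∀ u : (𝓞 K)ˣ, (u : 𝓞 K) - 1 ∈ 𝔪 → u = 1)
    (e : v.adicCompletionIntegers K ≃+* ℤ_[p]) (hle : 𝔪' ≤ 𝔪) (hv' : ¬ 𝔪' ≤ v.asIdeal)
    {α : 𝓞 K} (hα0 : α ≠ 0) (hα𝔪 : α - 1 ∈ 𝔪') (hαv : α ∉ v.asIdeal) {σ : absoluteGaloisGroup K}
    (hσ : ∀ n : ℕ, absRestrictNormalHom (rayClassField K (𝔪' * v.asIdeal ^ n)) σ =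
      artinHom (galFrob K (rayClassField K (𝔪' * v.asIdeal ^ n)))
        (toPrincipalIdeal (𝓞 K) K (Units.mk0 (α : K) (by exact_mod_cast hα0))))
    (hσ𝔪 : σ ∈ (absRestrictNormalHom (rayClassField K 𝔪)).ker) {s : ℕ}
    (hs1 : α - 1 ∈ v.asIdeal ^ (s + 1)) (hs2 : α - 1 ∉ v.asIdeal ^ (s + 2)) (hp2 : p = 2 → 1 ≤ s) :
    ∀ a : ℕ, ∃ m,
      p ^ a ∣ orderOf ((rayAdicTower (𝔪 := 𝔪) h𝔪' v).proj m (⟨σ, hσ𝔪⟩ : ↥(absRestrictNormalHom (rayClassField K 𝔪)).ker)) :=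
  SubgroupTower.hunb_of_character (rayAdicTower (𝔪 := 𝔪) h𝔪' v) _ (mem_rayAdicTower_iff h𝔪' h𝔪 hv hw e hle hv')
    ((artin_mem_rayAdicTower_U_iff h𝔪' hv' (units_eq_one_of_sub_one_mem_of_le hle hw) hα0 hα𝔪 hαv hσ hσ𝔪 0).mpr
      (by rw [zero_add, pow_one]; exact Ideal.pow_le_self (Nat.succ_ne_zero s) hs1))
    ((toZModPow_padicRayAdicCharacter_artin_eq_one_iff h𝔪' h𝔪 hv hw e hle hv' hα0 hα𝔪 hαv hσ hσ𝔪 (s + 1)).mpr hs1)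
    (fun h ↦ hs2 ((toZModPow_padicRayAdicCharacter_artin_eq_one_iff h𝔪' h𝔪 hv hw e hle hv' hα0 hα𝔪 hαv hσ
      hσ𝔪 (s + 2)).mp h)) hp2

end Artin

/-! ### §8. `hcent` and `hτ` on the global tower -/

section Cent

variable {𝔪 𝔪' : Ideal (𝓞 K)} {v : HeightOneSpectrum (𝓞 K)}

omit [NumberField K] in
/-- The commutators of `Γ_K` restrict trivially to every finite ABELIAN `L ⊆ K̄`.
[cite: NeukirchANT1999, Ch. IV §1 Thm. (1.1)] -/
theorem commutator_le_ker_absRestrictNormalHom_of_isAbelianGalois (L : IntermediateField K (AlgebraicClosure K))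
    [IsAbelianGalois K L] : commutator (absoluteGaloisGroup K) ≤ (absRestrictNormalHom L).ker := by
  rw [commutator_eq_closure, Subgroup.closure_le]
  rintro g ⟨a, b, rfl⟩
  rw [SetLike.mem_coe, MonoidHom.mem_ker, map_commutatorElement, commutatorElement_eq_one_iff_commute]
  exact commute_of_isAbelianGalois L _ _

/-- **`hcent` for the global tower**: every level `U_m = Gal(K̄/K(𝔪'v^{m+1}))` contains the commutators of
`G = Gal(K̄/K(𝔪))` (`K(𝔪'v^{m+1})/K` is abelian), so every `U_s` is central modulo every level — the
hypothesis `hcent` of `exists_twisting_μ_eq_of_cocycle_natCast` VERBATIM. [cite: deShalit1987, II.4.12 (p. 66)] -/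
theorem hcent_rayAdicTower (h𝔪' : 𝔪' ≠ ⊥) (s : ℕ) :
    ∀ m, ∀ g : ↥(absRestrictNormalHom (rayClassField K 𝔪)).ker, ∀ u ∈ (rayAdicTower (𝔪 := 𝔪) h𝔪' v).U s,
      g * u * g⁻¹ * u⁻¹ ∈ (rayAdicTower (𝔪 := 𝔪) h𝔪' v).U m := by
  refine SubgroupTower.hcent_of_commutator_le (rayAdicTower (𝔪 := 𝔪) h𝔪' v) (fun m ↦ ?_) s
  rw [commutator_eq_closure, Subgroup.closure_le]
  rintro g ⟨a, b, rfl⟩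
  rw [SetLike.mem_coe, mem_rayAdicTower_U_iff, commutatorElement_def, Subgroup.coe_mul, Subgroup.coe_mul,
    Subgroup.coe_mul, Subgroup.coe_inv, Subgroup.coe_inv, ← commutatorElement_def]
  exact commutator_le_ker_absRestrictNormalHom_of_isAbelianGalois _
    (Subgroup.commutator_mem_commutator (Subgroup.mem_top _) (Subgroup.mem_top _))

variable [IsTotallyComplex K] {p : ℕ} [hp : Fact p.Prime]

/-- **`hτ` for two Artin symbols `σ_(α)`, `σ_(β)`** (`α, β ≡ 1 mod 𝔪'`, `v ∤ αβ`): if `βᵏ ≠ αᵏ` in `K_v`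
for every `k > 0` (e.g. `β = ᾱ` with `α/ᾱ` not a root of unity — de Shalit's `𝔞₂ = 𝔞̄₁`), then every
`σ_(β)ᵏ σ_(α)⁻ᵏ` is separated from `1` by some level `n ≥ s` — the hypothesis `hτ` of
`exists_twisting_μ_eq_of_cocycle_natCast` VERBATIM (`κ_p(σ_(α)) = e(α_v⁻¹)`, `κ_p(σ_(β)) = e(β_v⁻¹)`).
[cite: deShalit1987, II.4.12 (p. 67–68)] -/
theorem hτ_artin (h𝔪' : 𝔪' ≠ ⊥) (h𝔪 : 𝔪 ≠ ⊥) (hv : ¬ 𝔪 ≤ v.asIdeal)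
    (hw : ∀ u : (𝓞 K)ˣ, (u : 𝓞 K) - 1 ∈ 𝔪 → u = 1) (e : v.adicCompletionIntegers K ≃+* ℤ_[p])
    (hle : 𝔪' ≤ 𝔪) (hv' : ¬ 𝔪' ≤ v.asIdeal) {α β : 𝓞 K} (hα0 : α ≠ 0) (hα𝔪 : α - 1 ∈ 𝔪')
    (hαv : α ∉ v.asIdeal) (hβ0 : β ≠ 0) (hβ𝔪 : β - 1 ∈ 𝔪') (hβv : β ∉ v.asIdeal)
    {σ τ : absoluteGaloisGroup K}
    (hσ : ∀ n : ℕ, absRestrictNormalHom (rayClassField K (𝔪' * v.asIdeal ^ n)) σ =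
      artinHom (galFrob K (rayClassField K (𝔪' * v.asIdeal ^ n)))
        (toPrincipalIdeal (𝓞 K) K (Units.mk0 (α : K) (by exact_mod_cast hα0))))
    (hτ : ∀ n : ℕ, absRestrictNormalHom (rayClassField K (𝔪' * v.asIdeal ^ n)) τ =
      artinHom (galFrob K (rayClassField K (𝔪' * v.asIdeal ^ n)))
        (toPrincipalIdeal (𝓞 K) K (Units.mk0 (β : K) (by exact_mod_cast hβ0))))
    (hσ𝔪 : σ ∈ (absRestrictNormalHom (rayClassField K 𝔪)).ker)
    (hτ𝔪 : τ ∈ (absRestrictNormalHom (rayClassField K 𝔪)).ker)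
    (hne : ∀ k : ℕ, 0 < k → ((β : K) : v.adicCompletion K) ^ k ≠ ((α : K) : v.adicCompletion K) ^ k) (s : ℕ) :
    ∀ k, 0 < k → ∃ n, s ≤ n ∧
      (⟨τ, hτ𝔪⟩ : ↥(absRestrictNormalHom (rayClassField K 𝔪)).ker) ^ k *
        ((⟨σ, hσ𝔪⟩ : ↥(absRestrictNormalHom (rayClassField K 𝔪)).ker) ^ k)⁻¹ ∉ (rayAdicTower (𝔪 := 𝔪) h𝔪' v).U n := by
  have hw' := units_eq_one_of_sub_one_mem_of_le hle hw
  have hσ' : σ ∈ (absRestrictNormalHom (rayClassField K 𝔪')).ker :=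
    mem_ker_of_forall_absRestrictNormalHom_eq_artinHom h𝔪' hv' hα0 hα𝔪 hαv hσ
  have hτ' : τ ∈ (absRestrictNormalHom (rayClassField K 𝔪')).ker :=
    mem_ker_of_forall_absRestrictNormalHom_eq_artinHom h𝔪' hv' hβ0 hβ𝔪 hβv hτ
  refine SubgroupTower.hτ_of_character (rayAdicTower (𝔪 := 𝔪) h𝔪' v)
    (((Units.map (e : v.adicCompletionIntegers K →+* ℤ_[p]).toMonoidHom).comp (rayAdicCharacter h𝔪 hv hw)))
    (mem_rayAdicTower_iff h𝔪' h𝔪 hv hw e hle hv') s fun k hk heq ↦ hne k hk ?_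
  -- the values: `κ(σ_(α)) = α_v⁻¹`, `κ(σ_(β)) = β_v⁻¹`
  have hκσ : rayAdicCharacter h𝔪 hv hw ⟨σ, hσ𝔪⟩ = (integerUnit v α hαv)⁻¹ := by
    rw [show (⟨σ, hσ𝔪⟩ : ↥(absRestrictNormalHom (rayClassField K 𝔪)).ker) =
      ⟨σ, ker_absRestrictNormalHom_rayClassField_anti h𝔪' hle hσ'⟩ from rfl,
      rayAdicCharacter_eq_of_le h𝔪 hv hw h𝔪' hle hv' hw' ⟨σ, hσ'⟩,
      rayAdicCharacter_eq_integerUnit_inv h𝔪' hv' hw' hα0 hα𝔪 hαv hσ]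
  have hκτ : rayAdicCharacter h𝔪 hv hw ⟨τ, hτ𝔪⟩ = (integerUnit v β hβv)⁻¹ := by
    rw [show (⟨τ, hτ𝔪⟩ : ↥(absRestrictNormalHom (rayClassField K 𝔪)).ker) =
      ⟨τ, ker_absRestrictNormalHom_rayClassField_anti h𝔪' hle hτ'⟩ from rfl,
      rayAdicCharacter_eq_of_le h𝔪 hv hw h𝔪' hle hv' hw' ⟨τ, hτ'⟩,
      rayAdicCharacter_eq_integerUnit_inv h𝔪' hv' hw' hβ0 hβ𝔪 hβv hτ]
  rw [coe_padicRayAdicCharacter_apply, coe_padicRayAdicCharacter_apply, hκσ, hκτ, ← map_pow, ← map_pow] at heq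
  -- `(β_v⁻¹)^k = (α_v⁻¹)^k` in `𝒪_vˣ`, hence `β_v^k = α_v^k`, hence `β^k = α^k` in `K_v`
  have h1 : ((integerUnit v β hβv)⁻¹) ^ k = ((integerUnit v α hαv)⁻¹) ^ k := by
    apply Units.ext
    rw [Units.val_pow_eq_pow_val, Units.val_pow_eq_pow_val]
    exact e.injective heq
  rw [inv_pow, inv_pow, inv_inj] at h1
  have h2 := congrArg (fun u : (v.adicCompletionIntegers K)ˣ ↦ ((u : v.adicCompletionIntegers K) :
    v.adicCompletion K)) h1
  simpa only [Units.val_pow_eq_pow_val, SubmonoidClass.coe_pow, coe_integerUnit] using h2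

end Cent

end Literature.NumberTheory.NumberFields

end
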